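import Summits.BirchSwinnertonDyer.Rank1Residual.GaloisImage.KolyvaginLevelOneNineDivides
import Summits.BirchSwinnertonDyer.Rank1Residual.GaloisImage.KolyvaginBaseRigidity
import HarnessLib

/-!
# END-m1 "nine divides Ш" WITHOUT [S24]: the injectivity input at the core vertex `∅` discharged by
# BASE RIGIDITY (cell `b2b-bsdres`, team n1011, ROUTE-1 §33.3 / §34.3 sub-targets R1-57 / R1-58,
# FILE A part 3; row T-R1-57-A, seat p09 GEN 7; skeleton `cells/n1011/skel/T-R1-57-A.md` §6)

HONEST FRAMING (cell `b2b-bsdres`, run/shared/lean/b2b/bsd-rank1-residual/, verbatim in every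
file): the goal of the cell is to DELETE the COMBINATION-SHAPED residual classes of the
Birch–Swinnerton-Dyer formula for ALL analytic-rank `≤ 1` elliptic curves over `ℚ` — "full BSD
formula for every rank `≤ 1` curve in class `C`" assembled STRICTLY from published theorems — so
that the rank-`≤ 1` remainder becomes exactly the CONSTRUCTION-SHAPED classes, which are TYPED
(missing-input `Prop`s), NOT attempted. This is not "finishing BSD". Team n1011: research route on
the CONSTRUCTION-SHAPED class X4 (§I N11, class A1); no claim beyond the stated classes; nothing
booked; no mark / label moved. Theorems only: no definition, no named fact, no `sorry`.  END-m1 is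
DEBT REDUCTION (the `v ∈ {1, 2}` rows of N11 LOWER@3), not coverage: the port DICT3₁
(`KatoKuriharaDictionaryThreeOneAt`, construction-shaped) remains a HYPOTHESIS.

## What and why

`KolyvaginLevelOneNineDivides` (p289201) proved END-m1 —
`exists_ne_zero_mem_selmerGroup_three_of_dictionaryOne_of_levelOne_certificate`: DICT3₁ + `3 ∣ [0]⁺` +
ONE level `n` with `δ̃_n(ψ₀) ≢ 0 (mod 3)` ⟹ `∃ x ∈ Sel₃(E/ℚ), x ≠ 0` — modulo ONE injectivity
hypothesis `hinj` at the core vertex `∅` ("a Kolyvagin system for `(E[3], 𝓕̄_can, 𝒫(τ))` with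
`H¹_{𝓕̄_can^*} = 0` and `κ_∅ = 0` vanishes"); `KolyvaginLevelOneNineDividesOfS24` (p289712) supplied
`hinj` from the pinned named fact [S24] Thm. 4.4 (1) as an INTERIM.  n1011-p11's R1-58
`CoreRankOne.apply_eq_zero_of_apply_empty_eq_zero` (`KolyvaginBaseRigidity`, p290143: Rubin
Prop. 2.3.2 (1) / Cor. 2.8.9 (2) at the EMPTY core vertex, `m = 1`, needing ONE mixed pair of classes
and three Poitou–Tate counts — r1 ROUTE-1 §34.3) now makes `hinj` a THEOREM.  This file is the
binder swap announced in both files' docstrings: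

* §1 `CoreRankOne.torsion_apply_eq_zero_of_apply_empty_eq_zero_rat` — base rigidity for `E[p]` over
  `ℚ` (`p` odd, `ρ̄_{E,p}` onto), ANY Selmer structure `𝓕` unramified outside an admissible `S` with
  `#H¹_𝓕 = p`, `H¹_{𝓕^*} = 0`, any admissible datum on Sakamoto's `𝒫(τ)` with the cyclotomic
  transverse conditions: the local shape (`hU hT hUT`) by n1011-p07/p18's ℚ-readings, the mixed pair
  by Sakamoto's Cor. 5.5 (n1011-p15, T-C55K) with the dual class moved along the inverse Weil map
  (pattern of `CoreRankZero.torsion_dualSelmerGroup_atLevel_eq_bot_of_apply_ne_zero_rat`).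
* §2 `kolyvaginSystem_eq_zero_of_apply_empty_eq_zero_of_baseRigidity` — LITERALLY the hypothesis
  `hinj` of END-m1 on `(E[3], 𝓕̄_can)`, as a theorem: `#H¹_{𝓕̄_can} = 3` from the core rank
  `χ(𝓕̄_can) = 1` (n1011-p13/p04, a theorem modulo `hEP`) and `H¹_{𝓕̄_can^*} = 0`; admissibility from
  THE canonical comparison maps (n1011-p04).  Binders = the interim's MINUS `hS24`, MINUS `hunro`.
* §3 `exists_ne_zero_mem_selmerGroup_three_of_dictionaryOne_of_levelOne_certificate_of_baseRigidity`
  and `natCard_selmerGroup_three_ne_one_…_of_baseRigidity` — END-m1 with `hinj` discharged: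
  0 [S24] binders.  Binder list = `…_of_S24`'s with `hS24` and `hunro` DELETED, same order (the
  record side, n1011-p18's `KuriharaRecordBSDpThreeLevelOneEnd`, swaps by deleting two arguments).

Remaining hypotheses of record (nothing hidden): `[IsGloballyMinimal]`, `[Finite E[3]]`, surj(3), the
`τ`-datum, the Poitou–Tate family `inv` ×3, Tate's `hEP`, the admissible `S` (with its infinite
place), the Kolyvagin datum on `E[3]` (`D η hP hT hD`), `v₃ ∣ 3`, THE PORT `hDict` (DICT3₁ — the
typed located gap), the row (`Addv`, `3 ∤ c₃`, `#E(ℚ₃)[3] = 1`), the parametrisation with `3 ∤ c_P`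
and the unit period transfer, `3 ∣ [0]⁺`, the certificate (`n`, `ψ₀`, `δ̃_n(ψ₀) ≠ 0`).

References: [Rubin2011] Prop. 2.3.2 (1), Prop. 2.7.1, Thm. 2.8.4, Cor. 2.8.9 (pp. 19–26);
[Sakamoto2024] Cor. 5.5 (p. 929), Prop. 7.6 (p. 936); [Kim2022StructureSelmer] Thm. 3.13;
r1 `cells/n1011/ROUTE-1.md` §33.3, §34.3.
-/

noncomputable section

open scoped Classical NumberField ContRepresentation
open Function Field NumberField IsDedekindDomain
open WeierstrassCurve Literature.NumberTheory.EllipticCurves Literature.NumberTheory.EllipticCurves.ModularForms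
  Literature.NumberTheory.EllipticCurves.Rank1Residual
  Literature.NumberTheory.EllipticCurves.Rank1Residual.Typed
  Literature.NumberTheory.GaloisRepresentations
  Literature.NumberTheory.GaloisRepresentations.DiscreteGaloisModule Literature.NumberTheory.GaloisCohomology
open Literature.NumberTheory.DiophantineGeometry.Dioph (ratModP)

namespace Summit.BirchSwinnertonDyer.Rank1Residual.GaloisImage

open Summit.BirchSwinnertonDyer.Rank1Residual.X11b.LocBridge
open Summit.BirchSwinnertonDyer.Rank1Residual.GaloisImage.CoreRankZero

/-! ## §1. Base rigidity for `E[p]` over `ℚ`: local shape and the mixed pair discharged -/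

namespace CoreRankOne

/-- **Base rigidity for `E[p]` over `ℚ`, `p` odd, `ρ̄_{E,p}` onto.**  `𝓕` is ANY Selmer structure on
`E[p]` unramified outside the finite `S ⊇ ∞ ∪ {p} ∪ Ram(E[p])` with `#H¹_𝓕(ℚ, E[p]) = p` and
`H¹_{𝓕^*}(ℚ, E[p]^∨(1)) = 0` (the empty level is a core vertex), `D` a Kolyvagin datum on Sakamoto's
primes `𝒫(τ) = frobeniusClassPrimes ρ {v | v ∈ S} τ p` (`τ ∈ Γ_{ℚ(μ_p)}`, `E[p]/(τ−1)E[p] ≅ ℤ/p`) with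
the cyclotomic transverse conditions and admissible comparison maps.  THEN every Kolyvagin system
`κ ∈ KS₁(E[p], 𝓕, 𝒫(τ))` with `κ_∅ = 0` vanishes at every level.  n1011-p11's
`apply_eq_zero_of_apply_empty_eq_zero` (R1-58) with: `#H¹_ur = p` (`natCard_unramifiedSubgroup_toLocal_of_primes_eq`),
`#H¹_tr = p` and `H¹ = H¹_ur + H¹_tr` (the ℚ-readings `natCard_transverse_rat_of_primes_eq_of_smul_eq_zero'`,
`unramifiedSubgroup_sup_transverse_eq_top_rat_of_primes_eq_of_smul_eq_zero'`); the ONE mixed pair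
from Sakamoto's Cor. 5.5 (n1011-p15 `PrimeChoice.hC55_of_hasSurjectiveModNGaloisRep`), the dual
class transported along the inverse Weil map (injective on `H¹`: `map_weilDual_map_weilDualInv`).
[cite: Rubin2011, Prop. 2.3.2 (1) and Cor. 2.8.9 (2) (pp. 19, 25), Prop. 2.7.1 (p. 23)]
[cite: Sakamoto2024, Cor. 5.5 (p. 929) and Prop. 7.6 (p. 936)] [cite: SilvermanAEC2009, Prop. III.8.1] -/
theorem torsion_apply_eq_zero_of_apply_empty_eq_zero_rat (W : WeierstrassCurve ℚ) [W.IsElliptic]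
    (p : ℕ) [Fact p.Prime] (hp2 : p ≠ 2) [Finite (geomTorsion W (p : ℤ))]
    (hsurj : W.HasSurjectiveModNGaloisRep (p : ℤ))
    {inv : LocalInvariants ℚ p}
    (hperf : inv.IsPerfect) (hsum : inv.SumLocalTermEqZero) (hcompl : inv.SelmerComplement)
    {S : Finset (Place ℚ)}
    (hS : ∀ v : HeightOneSpectrum (𝓞 ℚ), (Sum.inr v : Place ℚ) ∉ S →
      ((p : ℕ) : 𝓞 ℚ) ∉ v.asIdeal ∧ GaloisRep.IsUnramifiedAt v (W.torsionGaloisModule (p : ℤ)))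
    {𝓕 : SelmerStructure (W.torsionGaloisModule (p : ℤ))} (h𝓕 : 𝓕.IsUnramifiedOutside S)
    (h1 : Nat.card 𝓕.selmerGroup = p)
    (h0 : (inv.dualSelmerStructure (W.torsionGaloisModule (p : ℤ)) 𝓕).selmerGroup = ⊥)
    {D : KolyvaginDatum (W.torsionGaloisModule (p : ℤ))} {τ : absoluteGaloisGroup ℚ}
    (hP : D.primes = frobeniusClassPrimes (W.torsionGaloisModule (p : ℤ))
      {v | (Sum.inr v : Place ℚ) ∈ S} τ p)
    (hT : D.transverse = cyclotomicTransverse (W.torsionGaloisModule (p : ℤ)))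
    (hτ : Nonempty (cokerSubOne (W.torsionGaloisModule (p : ℤ)) τ ≃+ ZMod p))
    (hτμ : τ ∈ rootsOfUnityFixer ℚ p)
    (hadm : D.IsAdmissible)
    {κ : Finset (HeightOneSpectrum (𝓞 ℚ)) → galoisCohomology (W.torsionGaloisModule (p : ℤ)) 1}
    (hκ : D.IsKolyvaginSystem 𝓕 κ) (hκ₀ : κ ∅ = 0) (n : Finset (HeightOneSpectrum (𝓞 ℚ))) :
    κ n = 0 := by
  have hp : p.Prime := Fact.out
  haveI : NeZero p := ⟨hp.ne_zero⟩
  obtain ⟨e, hμ, hadd₁, hadd₂, -, hnondeg, hgal⟩ :=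
    exists_weilPairing_holds W p hp.two_le (Nat.cast_ne_zero.2 hp.ne_zero)
  -- `E[p]` is killed by `p`
  have hM : ∀ m : geomTorsion W (p : ℤ), p • m = 0 := fun T => AddSubgroup.torsionBy.nsmul T
  -- the primes of `𝒫(τ)` lie outside `S` (definition of `frobeniusClassPrimes`)
  have hPS : ∀ q ∈ D.primes, (Sum.inr q : Place ℚ) ∉ S := by
    intro q hq
    rw [hP] at hq
    exact hq.1
  -- the local shape at the Kolyvagin primes (Rubin Prop. 1.4.13 (1); n1011-p18, T-R1-16-LOC)
  have hU := natCard_unramifiedSubgroup_toLocal_of_primes_eq (W.torsionGaloisModule (p : ℤ)) hP hτ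
  have hT' := natCard_transverse_rat_of_primes_eq_of_smul_eq_zero' (W.torsionGaloisModule (p : ℤ))
    hP hT hτ hτμ hM
  have hUT := unramifiedSubgroup_sup_transverse_eq_top_rat_of_primes_eq_of_smul_eq_zero'
    (W.torsionGaloisModule (p : ℤ)) hP hT hτμ hM
  -- the mixed pair: Sakamoto Cor. 5.5 (n1011-p15) on `x, θ'y, θ'y`, `θ'` the inverse Weil map
  have hC55 := PrimeChoice.hC55_of_hasSurjectiveModNGaloisRep W p hp2 hsurj hP hτ
  have hθ' : Injective (galoisCohomology.map (weilDualInv W p e hμ hadd₁ hadd₂ hgal hnondeg) 1) := by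
    intro y y' h
    have h' := congrArg (galoisCohomology.map (weilDualIntertwining W p e hμ hadd₁ hadd₂ hgal) 1) h
    rwa [map_weilDual_map_weilDualInv, map_weilDual_map_weilDualInv] at h'
  refine apply_eq_zero_of_apply_empty_eq_zero hperf hsum hcompl hM hS h𝓕 h1 h0 hPS hadm hU hT' hUT
    (fun x hx y hy => ?_) hκ hκ₀ n
  have hy' : galoisCohomology.map (weilDualInv W p e hμ hadd₁ hadd₂ hgal hnondeg) 1 y ≠ 0 :=
    fun h => hy (hθ' (by rw [h, map_zero]))
  refine (hC55 x _ _ hx hy' hy').mono fun q hq => ⟨hq.1, hq.2.1, fun h0' => hq.2.2.1 ?_⟩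
  rw [localization_map_one_eq, h0']
  exact map_zero _

end CoreRankOne

/-! ## §2. The N11 reading: the hypothesis `hinj` of END-m1 on `(E[3], 𝓕̄_can)` is a theorem -/

variable (W : WeierstrassCurve ℚ) [W.IsElliptic]

/-- **Injectivity at the core vertex `∅` on `(E[3], 𝓕̄_can)` by BASE RIGIDITY — the hypothesis `hinj`
of `exists_ne_zero_mem_selmerGroup_three_of_dictionaryOne_of_levelOne_certificate` LITERALLY, as a
theorem with NO [S24] binder** (replaces the interim `kolyvaginSystem_eq_zero_of_apply_empty_eq_zero_of_S24`;
binders = its MINUS `hS24`, MINUS `hunro`).  `𝓕̄_can = propagatedSelmerStructureOne W 3` is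
unramified outside `S ⊇ ∞ ∪ {3} ∪ {bad}` (n1011-p13); `H¹_{𝓕̄_can^*} = 0` (the hypothesis) and the
core rank `#H¹_{𝓕̄_can} = 3 · #H¹_{𝓕̄_can^*}` (n1011-p13/p04
`hasCoreRank_one_propagatedSelmerStructureOne_of_isPerfect_of_localEuler`, a theorem modulo `hEP`)
give `#H¹_{𝓕̄_can} = 3`; admissibility of THE canonical comparison maps (n1011-p04
`FSComp.isAdmissible_of_hasCanonicalComparison_frobeniusClassPrimes`); then §1 at `p = 3`.
[cite: Rubin2011, Prop. 2.3.2 (1) and Cor. 2.8.9 (2) (pp. 19, 25)] [cite: Sakamoto2024, Cor. 5.5 (p. 929)]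
[cite: MazurRubin2004, Lemma 1.2.3] -/
theorem kolyvaginSystem_eq_zero_of_apply_empty_eq_zero_of_baseRigidity
    [Finite (geomTorsion W ((3 : ℕ) : ℤ))]
    (h3 : W.HasSurjectiveModNGaloisRep ((3 : ℕ) : ℤ))
    (τ : absoluteGaloisGroup ℚ) (hτμ : τ ∈ rootsOfUnityFixer ℚ 3)
    (hτq : Nonempty (cokerSubOne (W.torsionGaloisModule ((3 : ℕ) : ℤ)) τ ≃+ ZMod 3))
    (inv : LocalInvariants ℚ 3) (hperf : inv.IsPerfect) (hsum : inv.SumLocalTermEqZero)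
    (hcompl : inv.SelmerComplement)
    (hEP : ∀ v : HeightOneSpectrum (𝓞 ℚ), localEulerPoincareCharacteristic (v.adicCompletion ℚ))
    (S : Finset (Place ℚ)) (hS : ∀ w : InfinitePlace ℚ, (Sum.inl w : Place ℚ) ∈ S)
    (h3S : ∀ v : HeightOneSpectrum (𝓞 ℚ), ((3 : ℕ) : 𝓞 ℚ) ∈ v.asIdeal → (Sum.inr v : Place ℚ) ∈ S)
    (hbadS : ∀ v : HeightOneSpectrum (𝓞 ℚ), ¬ W.HasGoodReductionAt v → (Sum.inr v : Place ℚ) ∈ S)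
    (D : KolyvaginDatum (W.torsionGaloisModule ((3 : ℕ) : ℤ)))
    (η : (q : HeightOneSpectrum (𝓞 ℚ)) → (ZMod (Ideal.absNorm q.asIdeal))ˣ)
    (hP : D.primes = frobeniusClassPrimes (W.torsionGaloisModule ((3 : ℕ) : ℤ))
      {v | (Sum.inr v : Place ℚ) ∈ S} τ 3)
    (hT : D.transverse = cyclotomicTransverse (W.torsionGaloisModule ((3 : ℕ) : ℤ)))
    (hD : D.HasCanonicalComparison 3 η) :
    ∀ κ : Finset (HeightOneSpectrum (𝓞 ℚ)) → galoisCohomology (W.torsionGaloisModule ((3 : ℕ) : ℤ)) 1,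
      D.IsKolyvaginSystem (propagatedSelmerStructureOne W 3) κ →
      (inv.dualSelmerStructure (W.torsionGaloisModule ((3 : ℕ) : ℤ))
        (D.atLevel (propagatedSelmerStructureOne W 3) ∅)).selmerGroup = ⊥ →
      κ ∅ = 0 → ∀ m, κ m = 0 := by
  intro κ hκ hcore hk0 m
  haveI : Fact (Nat.Prime 3) := ⟨Nat.prime_three⟩
  -- the finite places of `S`
  let T : Finset (HeightOneSpectrum (𝓞 ℚ)) := S.preimage Sum.inr Sum.inr_injective.injOn
  have h3T : ∀ v : HeightOneSpectrum (𝓞 ℚ), ((3 : ℕ) : 𝓞 ℚ) ∈ v.asIdeal → v ∈ T :=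
    fun v hv => Finset.mem_preimage.mpr (h3S v hv)
  have hbadT : ∀ v : HeightOneSpectrum (𝓞 ℚ), ¬ W.HasGoodReductionAt v → v ∈ T :=
    fun v hv => Finset.mem_preimage.mpr (hbadS v hv)
  -- `𝓕̄_can(∅) = 𝓕̄_can`, so the hypothesis says `H¹_{𝓕̄_can^*} = 0`
  have hempty : D.atLevel (propagatedSelmerStructureOne W 3) ∅ = propagatedSelmerStructureOne W 3 :=
    SelmerStructure.modify_empty _ D.transverse
  rw [hempty] at hcore
  -- `#H¹_{𝓕̄_can} = 3` by the core rank `χ(𝓕̄_can) = 1`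
  have hχ := hasCoreRank_one_propagatedSelmerStructureOne_of_isPerfect_of_localEuler W inv hperf hsum
    hcompl hEP T h3T hbadT
  have h1 : Nat.card (propagatedSelmerStructureOne W 3).selmerGroup = 3 := by
    rw [LocalInvariants.HasCoreRank, pow_one, hcore, AddSubgroup.card_bot, mul_one] at hχ
    exact hχ
  -- admissibility of THE canonical comparison maps (n1011-p04)
  have hadm : D.IsAdmissible :=
    FSComp.isAdmissible_of_hasCanonicalComparison_frobeniusClassPrimes
      (W.torsionGaloisModule ((3 : ℕ) : ℤ)) 3 {v | (Sum.inr v : Place ℚ) ∈ S} hτq hτμ hP hD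
  exact CoreRankOne.torsion_apply_eq_zero_of_apply_empty_eq_zero_rat W 3 (by decide) h3 hperf hsum
    hcompl (fun v hv => not_mem_and_isUnramifiedAt_three_of_not_mem W S h3S hbadS hv)
    (propagatedSelmerStructureOne_three_isUnramifiedOutside W S hS h3S hbadS) h1 hcore hP hT hτq hτμ
    hadm hκ hk0 m

/-! ## §3. END-m1 with `hinj` discharged: 0 [S24] binders -/

/-- **END-m1 "nine divides Ш" in `3`-Selmer currency, [S24]-FREE** (the binder swap announced in
`KolyvaginLevelOneNineDivides` / `…OfS24`): on a non-unit level-one row (`W/ℚ` globally minimal,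
additive at `3`, `3 ∤ c₃`, surj(3), `#E(ℚ₃)[3] = 1`, `3 ∣ [0]⁺`), the level-one dictionary DICT3₁ for a
Kolyvagin datum on `E[3]` of Sakamoto's shape and ONE level `n` with `δ̃_n(ψ₀) ≢ 0 (mod 3)` give a
non-zero class in `Sel^{(3)}(E/ℚ)` — `exists_ne_zero_mem_selmerGroup_three_of_dictionaryOne_of_levelOne_certificate`
with `hinj` SUPPLIED by `kolyvaginSystem_eq_zero_of_apply_empty_eq_zero_of_baseRigidity`.  Binders =
the interim `…_of_S24`'s with `hS24` and `hunro` DELETED (same order); the PORT `hDict` and every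
other input remain HYPOTHESES as listed in the module docstring.  Nothing booked; no mark moved.
[cite: Kim2022StructureSelmer, Thm. 3.13] [cite: Rubin2011, Thm. 2.8.4 and Cor. 2.8.9 (pp. 25–26)]
[cite: Sakamoto2024, Cor. 5.5 (p. 929)] -/
theorem exists_ne_zero_mem_selmerGroup_three_of_dictionaryOne_of_levelOne_certificate_of_baseRigidity
    [W.IsGloballyMinimal] [Finite (geomTorsion W ((3 : ℕ) : ℤ))]
    (h3 : W.HasSurjectiveModNGaloisRep ((3 : ℕ) : ℤ))
    (τ : absoluteGaloisGroup ℚ) (hτμ : τ ∈ rootsOfUnityFixer ℚ 3)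
    (hτq : Nonempty (cokerSubOne (W.torsionGaloisModule ((3 : ℕ) : ℤ)) τ ≃+ ZMod 3))
    (inv : LocalInvariants ℚ 3) (hperf : inv.IsPerfect) (hsum : inv.SumLocalTermEqZero)
    (hcompl : inv.SelmerComplement)
    (hEP : ∀ v : HeightOneSpectrum (𝓞 ℚ), localEulerPoincareCharacteristic (v.adicCompletion ℚ))
    (S : Finset (Place ℚ)) (hS : ∀ w : InfinitePlace ℚ, (Sum.inl w : Place ℚ) ∈ S)
    (h3S : ∀ v : HeightOneSpectrum (𝓞 ℚ), ((3 : ℕ) : 𝓞 ℚ) ∈ v.asIdeal → (Sum.inr v : Place ℚ) ∈ S)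
    (hbadS : ∀ v : HeightOneSpectrum (𝓞 ℚ), ¬ W.HasGoodReductionAt v → (Sum.inr v : Place ℚ) ∈ S)
    (D : KolyvaginDatum (W.torsionGaloisModule ((3 : ℕ) : ℤ)))
    (η : (q : HeightOneSpectrum (𝓞 ℚ)) → (ZMod (Ideal.absNorm q.asIdeal))ˣ)
    (hP : D.primes = frobeniusClassPrimes (W.torsionGaloisModule ((3 : ℕ) : ℤ))
      {v | (Sum.inr v : Place ℚ) ∈ S} τ 3)
    (hT : D.transverse = cyclotomicTransverse (W.torsionGaloisModule ((3 : ℕ) : ℤ)))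
    (hD : D.HasCanonicalComparison 3 η)
    (v₃ : HeightOneSpectrum (𝓞 ℚ)) (hv₃ : ((3 : ℕ) : 𝓞 ℚ) ∈ v₃.asIdeal)
    (hDict : KatoKuriharaDictionaryThreeOneAt W 0 D v₃)
    (hX : Addv W 3) (hc3 : ¬ 3 ∣ (W.baseChange ℚ_[3]).localTamagawaNumber ℤ_[3])
    (ht : Nat.card {Q : (W.baseChange ℚ_[3]).toAffine.Point // (3 : ℕ) • Q = 0} = 1)
    {N : ℕ} [NeZero N] (P : ModularParametrizationData W N)
    (hManin : ¬ ((3 : ℕ) : ℤ) ∣ P.maninConstant)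
    (hΩ : ∃ u : ℚ, ‖(u : ℚ_[3])‖ = 1 ∧ W.realPeriodRat = u * plusPeriod P.f)
    (hzero : ratModP 3 (ratPlusSymbol P.f 0) = 0)
    (n : Finset (HeightOneSpectrum (𝓞 ℚ))) (hn : D.IsLevel n)
    {ψ₀ : (ℓ : ℕ) → (ZMod ℓ)ˣ →* Multiplicative (ZMod 3)}
    (hψ₀ : ∀ q ∈ n, Function.Surjective (ψ₀ (Ideal.absNorm q.asIdeal)))
    (hcert : haveI : NeZero (∏ q ∈ n, Ideal.absNorm q.asIdeal) :=
        ⟨Finset.prod_ne_zero_iff.2 fun q _ => Assembly.absNorm_ne_zero q⟩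
      kuriharaNumber P.f 3 (∏ q ∈ n, Ideal.absNorm q.asIdeal) ψ₀ ≠ 0) :
    ∃ x ∈ (W.kummerSelmerStructure ((3 : ℕ) : ℤ)).selmerGroup, x ≠ 0 :=
  exists_ne_zero_mem_selmerGroup_three_of_dictionaryOne_of_levelOne_certificate W h3 inv hperf hsum
    hcompl hEP S h3S hbadS D v₃ hv₃ hDict hX hc3 ht P hManin hΩ hzero n hn hψ₀ hcert
    (kolyvaginSystem_eq_zero_of_apply_empty_eq_zero_of_baseRigidity W h3 τ hτμ hτq inv hperf hsum
      hcompl hEP S hS h3S hbadS D η hP hT hD)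

/-- **END-m1 in `W.selmerGroup (3 : ℤ)` currency, [S24]-FREE: `#Sel^{(3)}(E/ℚ) ≠ 1`** — the record
side's hypothesis shape (`natCard_selmerGroup_three_ne_one_of_dictionaryOne_of_levelOne_certificate`
with `hinj` supplied by base rigidity; same binders as the previous theorem).
[cite: Kim2022StructureSelmer, Thm. 3.13] [cite: Rubin2011, Thm. 2.8.4 and Cor. 2.8.9 (pp. 25–26)] -/
theorem natCard_selmerGroup_three_ne_one_of_dictionaryOne_of_levelOne_certificate_of_baseRigidity
    [W.IsGloballyMinimal] [Finite (geomTorsion W ((3 : ℕ) : ℤ))]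
    (h3 : W.HasSurjectiveModNGaloisRep ((3 : ℕ) : ℤ))
    (τ : absoluteGaloisGroup ℚ) (hτμ : τ ∈ rootsOfUnityFixer ℚ 3)
    (hτq : Nonempty (cokerSubOne (W.torsionGaloisModule ((3 : ℕ) : ℤ)) τ ≃+ ZMod 3))
    (inv : LocalInvariants ℚ 3) (hperf : inv.IsPerfect) (hsum : inv.SumLocalTermEqZero)
    (hcompl : inv.SelmerComplement)
    (hEP : ∀ v : HeightOneSpectrum (𝓞 ℚ), localEulerPoincareCharacteristic (v.adicCompletion ℚ))
    (S : Finset (Place ℚ)) (hS : ∀ w : InfinitePlace ℚ, (Sum.inl w : Place ℚ) ∈ S)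
    (h3S : ∀ v : HeightOneSpectrum (𝓞 ℚ), ((3 : ℕ) : 𝓞 ℚ) ∈ v.asIdeal → (Sum.inr v : Place ℚ) ∈ S)
    (hbadS : ∀ v : HeightOneSpectrum (𝓞 ℚ), ¬ W.HasGoodReductionAt v → (Sum.inr v : Place ℚ) ∈ S)
    (D : KolyvaginDatum (W.torsionGaloisModule ((3 : ℕ) : ℤ)))
    (η : (q : HeightOneSpectrum (𝓞 ℚ)) → (ZMod (Ideal.absNorm q.asIdeal))ˣ)
    (hP : D.primes = frobeniusClassPrimes (W.torsionGaloisModule ((3 : ℕ) : ℤ))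
      {v | (Sum.inr v : Place ℚ) ∈ S} τ 3)
    (hT : D.transverse = cyclotomicTransverse (W.torsionGaloisModule ((3 : ℕ) : ℤ)))
    (hD : D.HasCanonicalComparison 3 η)
    (v₃ : HeightOneSpectrum (𝓞 ℚ)) (hv₃ : ((3 : ℕ) : 𝓞 ℚ) ∈ v₃.asIdeal)
    (hDict : KatoKuriharaDictionaryThreeOneAt W 0 D v₃)
    (hX : Addv W 3) (hc3 : ¬ 3 ∣ (W.baseChange ℚ_[3]).localTamagawaNumber ℤ_[3])
    (ht : Nat.card {Q : (W.baseChange ℚ_[3]).toAffine.Point // (3 : ℕ) • Q = 0} = 1)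
    {N : ℕ} [NeZero N] (P : ModularParametrizationData W N)
    (hManin : ¬ ((3 : ℕ) : ℤ) ∣ P.maninConstant)
    (hΩ : ∃ u : ℚ, ‖(u : ℚ_[3])‖ = 1 ∧ W.realPeriodRat = u * plusPeriod P.f)
    (hzero : ratModP 3 (ratPlusSymbol P.f 0) = 0)
    (n : Finset (HeightOneSpectrum (𝓞 ℚ))) (hn : D.IsLevel n)
    {ψ₀ : (ℓ : ℕ) → (ZMod ℓ)ˣ →* Multiplicative (ZMod 3)}
    (hψ₀ : ∀ q ∈ n, Function.Surjective (ψ₀ (Ideal.absNorm q.asIdeal)))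
    (hcert : haveI : NeZero (∏ q ∈ n, Ideal.absNorm q.asIdeal) :=
        ⟨Finset.prod_ne_zero_iff.2 fun q _ => Assembly.absNorm_ne_zero q⟩
      kuriharaNumber P.f 3 (∏ q ∈ n, Ideal.absNorm q.asIdeal) ψ₀ ≠ 0) :
    Nat.card (W.selmerGroup (3 : ℤ)) ≠ 1 :=
  natCard_selmerGroup_three_ne_one_of_dictionaryOne_of_levelOne_certificate W h3 inv hperf hsum hcompl
    hEP S h3S hbadS D v₃ hv₃ hDict hX hc3 ht P hManin hΩ hzero n hn hψ₀ hcert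
    (kolyvaginSystem_eq_zero_of_apply_empty_eq_zero_of_baseRigidity W h3 τ hτμ hτq inv hperf hsum
      hcompl hEP S hS h3S hbadS D η hP hT hD)

end Summit.BirchSwinnertonDyer.Rank1Residual.GaloisImage

end
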